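import Literature.NumberTheory.LFunctions.AlmostMonomialLowDegree
import Literature.NumberTheory.LFunctions.AlmostMonomialAlternatingFive
import Literature.NumberTheory.LFunctions.AlmostMonomialSymmetricFive
import HarnessLib

/-!
# Booker 2006, Proposition 2.3 (first clause) DISCHARGED: `SL₂(𝔽₃)`, `A₅`, `S₅` are almost monomial

Topic `Literature/NumberTheory/LFunctions`.  This file discharges the NAMED FACT
`booker2006_proposition23` of `CertifiedArtinHolomorphyCriterion.lean`,

  `IsAlmostMonomial SL(2, ZMod 3) ∧ IsAlmostMonomial (alternatingGroup (Fin 5)) ∧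
    IsAlmostMonomial (Equiv.Perm (Fin 5))`,

by assembling the three proved conjuncts: `Booker2006.isAlmostMonomial_SL23`
(`AlmostMonomialLowDegree.lean`: all character degrees of `SL₂(𝔽₃)` are `≤ 3`, and irreducible
characters of degree `≤ 3` never split into two non-zero DM-positive virtual characters),
`Booker2006.isAlmostMonomial_alternatingGroup_five` (`AlmostMonomialAlternatingFive.lean`) and
`Booker2006.isAlmostMonomial_perm_fin_five` (`AlmostMonomialSymmetricFive.lean`) (monomial
characters with kernel-certified tables, the degree criterion).  Booker obtained the proposition
"with the aid of the computer algebra system GAP" (p. 390); here the Lean kernel plays that role.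
It cannot live in `CertifiedArtinHolomorphyCriterion.lean` itself (append protocol) because the
three proof files import that module.

Corollaries (one line each from the tree's `Booker2006.isRHCheckable_of_isAlmostMonomial`, Booker's
(2–6), p. 391): `SL₂(𝔽₃)`, `A₅` and `S₅` satisfy the condition (2–6) under which Booker's
RH-certification of Artin `L`-functions goes through (`isRHCheckable_SL23`, `_alternatingGroup_five`,
`_perm_fin_five`).  Together with `booker2006_proposition22_holds`
(`WeakAlmostMonomialArtinHolomorphy.lean`) both named facts of Booker's §2 used as hypotheses
elsewhere (`booker2006_proposition22`, `booker2006_proposition23`) are now theorems.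

## References

* [Booker2006] A. R. Booker, *Artin's conjecture, Turing's method, and the Riemann hypothesis*,
  Experiment. Math. **15** (2006) 385–407, §2 Proposition 2.3 (p. 390).
-/

namespace Literature.NumberTheory.LFunctions

open scoped MatrixGroups

/-- **Booker 2006, Proposition 2.3 (first clause), PROVED:** the groups `SL₂(𝔽₃)`, `A₅` and `S₅`
are almost monomial — the discharge of the named fact `booker2006_proposition23`.
[cite: Booker2006, §2 Proposition 2.3 p. 390] -/
theorem booker2006_proposition23_holds : booker2006_proposition23 :=
  ⟨Booker2006.isAlmostMonomial_SL23, Booker2006.isAlmostMonomial_alternatingGroup_five,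
    Booker2006.isAlmostMonomial_perm_fin_five⟩

namespace Booker2006

/-- `SL₂(𝔽₃)` satisfies Booker's condition (2–6). [cite: Booker2006, §2 (2–6) p. 391] -/
theorem isRHCheckable_SL23 : IsRHCheckable SL(2, ZMod 3) :=
  isRHCheckable_of_isAlmostMonomial isAlmostMonomial_SL23

/-- `A₅` satisfies Booker's condition (2–6). [cite: Booker2006, §2 (2–6) p. 391] -/
theorem isRHCheckable_alternatingGroup_five : IsRHCheckable (alternatingGroup (Fin 5)) :=
  isRHCheckable_of_isAlmostMonomial isAlmostMonomial_alternatingGroup_five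

/-- `S₅` satisfies Booker's condition (2–6). [cite: Booker2006, §2 (2–6) p. 391] -/
theorem isRHCheckable_perm_fin_five : IsRHCheckable (Equiv.Perm (Fin 5)) :=
  isRHCheckable_of_isAlmostMonomial isAlmostMonomial_perm_fin_five

end Booker2006

end Literature.NumberTheory.LFunctions
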